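import Summits.ResolutionOfSingularities.KangarooAtlas.MizutaniExpandShift
import Summits.ResolutionOfSingularities.KangarooAtlas.MizutaniLevelComparison
import HarnessLib

/-!
# The scheme of the shifted invariant forms is a Hironaka scheme iff `𝒥_{e'}𝒟_{e'}((L_B)_e) = (L_B)_e` (Mizutani 1973, Lemma 2.7, H-scheme half)

Cell `pub-rosobs`, Mizutani enclosure (seat mizutani-encloser-2, gen 9). AI-written; *AI review is weaker than expert
review*; NOT a resolution-of-singularities theorem (summit relevance C).

Companion to `MizutaniFrobeniusImage.lean` (the scheme half of Lemma 2.7: the Frobenius image `F^m(B_{P,𝔭})`, ideal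
`(U_+(𝔭)S).comap (expand p^m)`, EQUALS the subgroup scheme cut out by the shifted invariant additive forms,
`famIdeal (j ↦ (U(𝔭) ∩ L)_{j+m})` — `comap_expand_bIdeal`; it has the dimension of `B_{P,𝔭}` and is the Hironaka scheme of the
linear point of `(U ∩ L)_m` when `m ≥ exponent`).  This file is stated in terms of the SHIFTED-FORMS IDEAL
`famIdeal (j ↦ (U(𝔭) ∩ L)_{j+m})` only (it imports `MizutaniExpandShift` for `famIdeal_shift_le_comap_expand`, not
`MizutaniExpandTransport`), and uses encloser-1 g9's transcription of Mizutani's Thm. 1.3 / (*) (`MizutaniHSchemeCriterion.lean`: a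
subspace `V ⊊ k^{n+1}` is `(L_B)_{e'}` of a point of exponent `≤ e'` iff `𝒥_{e'}𝒟_{e'}(V) = V`, the point being the `q'`-linear point of
`𝒟_{e'}(V)` — `jCore`, `dSpan` of `MizutaniOdaOperators.lean`) to settle WHEN that scheme — i.e. the Frobenius image — is the Hironaka
scheme of a point in positive exponent `e' = e − m`:

* **`exists_point_bIdeal_eq_famIdeal_shift_of_jCore_dSpan_eq`** — if `exponent B(𝔭) ≤ e`, `m ≤ e` and
  `𝒥_{e−m}𝒟_{e−m}((L_B)_e(𝔭)) = (L_B)_e(𝔭)`, then `V(famIdeal (j ↦ (U∩L)_{j+m})) = F^m(B_{P,𝔭})` is `B_{P,𝔭'}` for the point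
  `𝔭' = qLinPoint (e−m) (𝒟_{e−m}((L_B)_e(𝔭)))` (Mizutani's `γ(𝒟_{e'}(N_e)S)`), with `(L_B)_j(𝔭') = (L_B)_{j+m}(𝔭)` for ALL `j`
  (levels `≥ e'` by the exponent, levels `< e'` by the level radical `N = rad_L(k[F]N_e)` of `MizutaniLevelRadical`),
  exponent `≤ e − m`, `dim B(𝔭') = dim B(𝔭)`;
* **`exists_point_bIdeal_eq_famIdeal_shift_iff_jCore_dSpan_eq`** — conversely a point `𝔭'` with
  `U_+(𝔭')S = famIdeal (j ↦ (U∩L)_{j+m})` has `(L_B)_{e−m}(𝔭') = (L_B)_e(𝔭)`, so `𝒥_{e−m}𝒟_{e−m}((L_B)_e(𝔭)) = (L_B)_e(𝔭)` is NECESSARY AND SUFFICIENT: Mizutani's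
  H-scheme property of the image is EQUIVALENT to the level-`(e−m)` closedness of the level-`e` invariant forms — which is
  what his Lemma 2.4 (`Diff_{q−1} = Diff_{q−q'}·Diff_{q'−1}`, with Oda 1973 Lemma 2.9) supplies; that inclusion
  `𝒥_{e'}𝒟_{e'} ≤ 𝒥_e𝒟_e` is NOT proved here;
* `jCore_dSpan_eq_of_le_of_mono`, **`exists_point_bIdeal_eq_famIdeal_shift_of_lemma24`** — with encloser-1 g9's reduction
  `jCore_dSpan_le_succ_of_lemma24` (`MizutaniLevelComparison.lean`: the monotonicity `𝒥_e𝒟_e ≤ 𝒥_{e+1}𝒟_{e+1}` follows from Lemma 2.4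
  in the DUAL PAIR FORM «`Σ_i D'(a_i)·D₀(c_i) = 0` for all `D' ∈ Diff_{p^e−1}(k/k^{p^e})`, `D₀ ∈ Diff_{p^{e+1}−p^e}(k/k^{p^{e+1}})` ⇒
  `Σ a_i ⊗ c_i ∈ J_{e+1}^{p^{e+1}}`»), the whole H-scheme half of Lemma 2.7 — every `m ≤ e`, every point — follows from that
  pair statement at all levels, which is the ONE remaining hypothesis (`h24`).

## References

* H. Mizutani, *Hironaka's additive group schemes*, Nagoya Math. J. 52 (1973) 85–95, Lemma 2.7 (p. 89–90), Lemma 2.4, Thm. 1.3.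
  [Mizutani1973HironakaGroupSchemes]
* T. Oda, *Hironaka's additive group scheme, II*, Publ. RIMS 19 (1983), §2 (p. 1168), Cor. 2.3. [Oda1983HironakaGroupSchemeII]
-/

noncomputable section

open MvPolynomial Literature.AlgebraicGeometry.Resolution Literature.AlgebraicGeometry.Resolution.HironakaScheme
  Literature.RingTheory.MvPolynomial

namespace Summit.ResolutionOfSingularities.KangarooAtlas.Mizutani

universe u

section Point

variable (k : Type u) [Field k] (p : ℕ) [hp : Fact p.Prime] [CharP k p] {n : ℕ}
  (𝔭 : Ideal (MvPolynomial (Fin (n + 1)) k))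

/-- **A point whose invariant forms are the shifted ones has `U_+(𝔭')S = famIdeal (j ↦ (U(𝔭) ∩ L)_{j+m})`** (`= F^m(U_+(𝔭)S)` by
`comap_expand_bIdeal`): both are the `famIdeal` of the shifted family. [cite: Mizutani1973HironakaGroupSchemes, Lemma 2.7] -/
theorem bIdeal_eq_famIdeal_shift_of_invForms_eq [𝔭.IsPrime] {𝔭' : Ideal (MvPolynomial (Fin (n + 1)) k)}
    [𝔭'.IsPrime] (hP' : IsPoint k 𝔭') {m : ℕ} (h : ∀ j, invForms k p 𝔭' j = invForms k p 𝔭 (j + m)) :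
    bIdeal k 𝔭' = famIdeal k p (fun j => hirForms k p 𝔭 (j + m)) := by
  have hfam : hirForms k p 𝔭' = fun j => hirForms k p 𝔭 (j + m) := by
    funext j
    rw [hirForms_eq_invForms 𝔭' j, hirForms_eq_invForms 𝔭 (j + m), h j]
  rw [bIdeal_eq_famIdeal_hirForms_holds k p 𝔭' hP', hfam]

/-- Conversely, **a point whose scheme is cut out by the shifted forms has the shifted invariant forms**:
`U_+(𝔭')S = famIdeal (j ↦ (U(𝔭) ∩ L)_{j+m})` forces `(L_B)_j(𝔭') = (L_B)_{j+m}(𝔭)` for every `j` (`L_e ∩ U_+S = (U ∩ L)_e` on both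
sides; `famIdeal (shift) ≤ (U_+(𝔭)S).comap (expand p^m)`). [cite: Mizutani1973HironakaGroupSchemes, Lemma 2.7] -/
theorem invForms_eq_of_bIdeal_eq_famIdeal_shift [𝔭.IsPrime] (hP : IsPoint k 𝔭) {𝔭' : Ideal (MvPolynomial (Fin (n + 1)) k)}
    [𝔭'.IsPrime] (hP' : IsPoint k 𝔭') {m : ℕ}
    (h : bIdeal k 𝔭' = famIdeal k p (fun j => hirForms k p 𝔭 (j + m))) (j : ℕ) :
    invForms k p 𝔭' j = invForms k p 𝔭 (j + m) := by
  ext a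
  rw [← hirForms_eq_invForms 𝔭' j, ← hirForms_eq_invForms 𝔭 (j + m), ← addForm_mem_bIdeal_iff k p 𝔭' hP', h]
  constructor
  · intro ha
    have h1 := famIdeal_shift_le_comap_expand k p (hirForms k p 𝔭) m ha
    rw [Ideal.mem_comap, expand_addForm, ← bIdeal_eq_famIdeal_hirForms_holds k p 𝔭 hP,
      addForm_mem_bIdeal_iff k p 𝔭 hP] at h1
    exact h1
  · intro ha
    exact Ideal.subset_span (Set.mem_iUnion.mpr ⟨j, a, ha, rfl⟩)

/-- **LEMMA 2.7, H-SCHEME HALF, from the level-`e'` closedness.**  Let `𝔭` be a point of `ℙ^n_k` with `exponent B(𝔭) ≤ e`, let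
`m ≤ e` and `e' = e − m`.  If `𝒥_{e'}𝒟_{e'}((L_B)_e(𝔭)) = (L_B)_e(𝔭)`, then the scheme `V(famIdeal (j ↦ (U∩L)_{j+m}))` — the Frobenius
image `F^m(B_{P,𝔭})` by `comap_expand_bIdeal` — IS the Hironaka scheme `B_{P,𝔭'}` of a point `𝔭'` of `ℙ^n_k` (Mizutani's
`γ(𝒟_{e'}(N_e)·S)`, the `p^{e'}`-linear point of `𝒟_{e'}((L_B)_e(𝔭))`), with `(L_B)_j(𝔭') = (L_B)_{j+m}(𝔭)` for all `j`, exponent `≤ e'`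
and `dim B(𝔭') = dim B(𝔭)`. [cite: Mizutani1973HironakaGroupSchemes, Lemma 2.7 (p. 89–90) with Thm. 1.3] -/
theorem exists_point_bIdeal_eq_famIdeal_shift_of_jCore_dSpan_eq [𝔭.IsPrime] (hP : IsPoint k 𝔭) {e m : ℕ} (hm : m ≤ e)
    (hE : ExponentLE k p 𝔭 e)
    (h24 : jCore k p (e - m) (dSpan k p (e - m) (invForms k p 𝔭 e)) = invForms k p 𝔭 e) :
    ∃ 𝔭' : Ideal (MvPolynomial (Fin (n + 1)) k), IsPoint k 𝔭' ∧
      bIdeal k 𝔭' = famIdeal k p (fun j => hirForms k p 𝔭 (j + m)) ∧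
      (∀ j, invForms k p 𝔭' j = invForms k p 𝔭 (j + m)) ∧ ExponentLE k p 𝔭' (e - m) ∧
      hsDim k p 𝔭' = hsDim k p 𝔭 := by
  have hne : invForms k p 𝔭 e ≠ ⊤ := invForms_ne_top k p e 𝔭 hP
  obtain ⟨hpt, hE', hV, -⟩ := qLinPoint_dSpan_realises k p (e - m) hne h24
  set 𝔭' := qLinPoint k p (e - m) (dSpan k p (e - m) (invForms k p 𝔭 e)) with h𝔭'
  haveI : 𝔭'.IsPrime := hpt.1
  -- the invariant forms of `𝔭'` are the shifted ones
  have hinv : ∀ j, invForms k p 𝔭' j = invForms k p 𝔭 (j + m) := by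
    intro j
    rcases le_or_gt (e - m) j with hj | hj
    · -- levels `≥ e'`: both are `span F^{j−e'}((L_B)_e(𝔭))`
      obtain ⟨i, rfl⟩ := Nat.exists_eq_add_of_le hj
      have h1 : e - m + i + m = e + i := by omega
      rw [hE' (e - m + i) hj, Nat.add_sub_cancel_left, hV, h1, hE (e + i) (Nat.le_add_right e i),
        Nat.add_sub_cancel_left]
    · -- levels `< e'`: the level radical on both sides
      ext a
      rw [mem_invForms_iff_frobVec_mem k p 𝔭' hpt j (e - m - j) a,
        mem_invForms_iff_frobVec_mem k p 𝔭 hP (j + m) (e - m - j) a]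
      have h1 : j + (e - m - j) = e - m := by omega
      have h2 : j + m + (e - m - j) = e := by omega
      rw [h1, h2, hV]
  refine ⟨𝔭', hpt, bIdeal_eq_famIdeal_shift_of_invForms_eq k p 𝔭 hpt hinv, hinv, hE', ?_⟩
  rw [← hsDimAt_eq_hsDim k p 𝔭' hE', ← hsDimAt_eq_hsDim k p 𝔭 hE]
  unfold hsDimAt
  rw [hV]

/-- **THE H-SCHEME PROPERTY OF THE FROBENIUS IMAGE ⟺ LEVEL-`e'` CLOSEDNESS.**  For a point `𝔭` with `exponent B(𝔭) ≤ e` and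
`m ≤ e`: the scheme of the shifted forms `V(famIdeal (j ↦ (U∩L)_{j+m})) = F^m(B_{P,𝔭})` is the Hironaka scheme `B_{P,𝔭'}` of SOME
point `𝔭'` of `ℙ^n_k` iff `𝒥_{e−m}𝒟_{e−m}((L_B)_e(𝔭)) = (L_B)_e(𝔭)` (necessity: such a `𝔭'` has `(L_B)_{e−m}(𝔭') = (L_B)_e(𝔭)`, and the
invariant forms of every point are `𝒥𝒟`-closed, `jCore_dSpan_invForms`).  Mizutani's Lemma 2.4 asserts the right-hand side for
every H-scheme; it is not proved in the tree. [cite: Mizutani1973HironakaGroupSchemes, Lemma 2.7 and Lemma 2.4; Thm. 1.3 (*) (i)] -/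
theorem exists_point_bIdeal_eq_famIdeal_shift_iff_jCore_dSpan_eq [𝔭.IsPrime] (hP : IsPoint k 𝔭) {e m : ℕ} (hm : m ≤ e)
    (hE : ExponentLE k p 𝔭 e) :
    (∃ 𝔭' : Ideal (MvPolynomial (Fin (n + 1)) k), 𝔭'.IsPrime ∧ IsPoint k 𝔭' ∧
      bIdeal k 𝔭' = famIdeal k p (fun j => hirForms k p 𝔭 (j + m))) ↔
      jCore k p (e - m) (dSpan k p (e - m) (invForms k p 𝔭 e)) = invForms k p 𝔭 e := by
  constructor
  · rintro ⟨𝔭', h', hP', hb⟩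
    have hV : invForms k p 𝔭' (e - m) = invForms k p 𝔭 e := by
      rw [invForms_eq_of_bIdeal_eq_famIdeal_shift k p 𝔭 hP hP' hb (e - m), Nat.sub_add_cancel hm]
    rw [← hV]
    exact jCore_dSpan_invForms k p 𝔭' (e - m)
  · intro h24
    obtain ⟨𝔭', hpt, hb, -, -, -⟩ := exists_point_bIdeal_eq_famIdeal_shift_of_jCore_dSpan_eq k p 𝔭 hP hm hE h24
    exact ⟨𝔭', hpt.1, hpt, hb⟩

/-! ### From Lemma 2.4 (dual pair form, `MizutaniLevelComparison`) to Lemma 2.7 in full -/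

/-- Monotone closures: if `𝒥_j𝒟_j(V) ≤ 𝒥_{j+1}𝒟_{j+1}(V)` for all `j`, then `𝒥_{e'}𝒟_{e'}(V) ≤ 𝒥_{e'+i}𝒟_{e'+i}(V)`. [folklore] -/
theorem jCore_dSpan_le_add_of_mono {V : Submodule k (Fin (n + 1) → k)}
    (hmono : ∀ j, jCore k p j (dSpan k p j V) ≤ jCore k p (j + 1) (dSpan k p (j + 1) V)) (e' i : ℕ) :
    jCore k p e' (dSpan k p e' V) ≤ jCore k p (e' + i) (dSpan k p (e' + i) V) := by
  induction i with
  | zero => exact le_rfl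
  | succ i ih => exact ih.trans (hmono (e' + i))

/-- **`𝒥_e𝒟_e(V) = V` and `e' ≤ e` give `𝒥_{e'}𝒟_{e'}(V) = V`, granted the monotonicity of the closures** (`V ≤ 𝒥_{e'}𝒟_{e'}V ≤ 𝒥_e𝒟_eV = V`).
[cite: Mizutani1973HironakaGroupSchemes, proof of Lemma 2.7 (𝒥_{e'}𝒟_{e'}(V) ⊂ 𝒥_e𝒟_e(V) = V)] -/
theorem jCore_dSpan_eq_of_le_of_mono {V : Submodule k (Fin (n + 1) → k)}
    (hmono : ∀ j, jCore k p j (dSpan k p j V) ≤ jCore k p (j + 1) (dSpan k p (j + 1) V)) {e e' : ℕ} (he : e' ≤ e)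
    (hV : jCore k p e (dSpan k p e V) = V) : jCore k p e' (dSpan k p e' V) = V := by
  obtain ⟨i, rfl⟩ := Nat.exists_eq_add_of_le he
  exact le_antisymm ((jCore_dSpan_le_add_of_mono k p hmono e' i).trans hV.le) (le_jCore_dSpan k p e' V)

/-- **LEMMA 2.7 IN FULL FROM LEMMA 2.4 (dual pair form).**  Grant, at every level `j`, Mizutani's Lemma 2.4 in the form used by
`jCore_dSpan_le_succ_of_lemma24` («if `Σ_i D'(a_i)·D₀(c_i) = 0` for all `D' ∈ Diff_{p^j−1}(k/k^{p^j})` and all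
`D₀ ∈ Diff_{p^{j+1}−p^j}(k/k^{p^{j+1}})`, then `Σ a_i ⊗ c_i ∈ J_{j+1}^{p^{j+1}}`»).  Then for every point `𝔭` of `ℙ^n_k` with
`exponent B(𝔭) ≤ e` and every `m ≤ e`, the scheme of the shifted forms `V(famIdeal (j ↦ (U∩L)_{j+m}))` — the Frobenius image
`F^m(B_{P,𝔭})` by `comap_expand_bIdeal` — is the Hironaka scheme `B_{P,𝔭'}` of a point `𝔭'` of exponent `≤ e − m` with
`(L_B)_j(𝔭') = (L_B)_{j+m}(𝔭)` and `dim B(𝔭') = dim B(𝔭)`. [cite: Mizutani1973HironakaGroupSchemes, Lemma 2.7 (p. 89–90) and Lemma 2.4] -/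
theorem exists_point_bIdeal_eq_famIdeal_shift_of_lemma24
    (h24 : ∀ (j : ℕ) (a c : Fin (n + 1) → k),
      (∀ (D' : k →ₗ[frobPow k p j] k) (D₀ : k →ₗ[frobPow k p (j + 1)] k), IsDiffOpLE (frobPow k p j) (p ^ j - 1) D' →
        IsDiffOpLE (frobPow k p (j + 1)) (p ^ (j + 1) - p ^ j) D₀ → ∑ i, D' (a i) * D₀ (c i) = 0) →
      tens k p (j + 1) a c ∈ KaehlerDifferential.ideal (frobPow k p (j + 1)) k ^ p ^ (j + 1))
    [𝔭.IsPrime] (hP : IsPoint k 𝔭) {e m : ℕ} (hm : m ≤ e) (hE : ExponentLE k p 𝔭 e) :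
    ∃ 𝔭' : Ideal (MvPolynomial (Fin (n + 1)) k), IsPoint k 𝔭' ∧
      bIdeal k 𝔭' = famIdeal k p (fun j => hirForms k p 𝔭 (j + m)) ∧
      (∀ j, invForms k p 𝔭' j = invForms k p 𝔭 (j + m)) ∧ ExponentLE k p 𝔭' (e - m) ∧
      hsDim k p 𝔭' = hsDim k p 𝔭 :=
  exists_point_bIdeal_eq_famIdeal_shift_of_jCore_dSpan_eq k p 𝔭 hP hm hE
    (jCore_dSpan_eq_of_le_of_mono k p (fun j => jCore_dSpan_le_succ_of_lemma24 k p j (h24 j) _) (Nat.sub_le e m)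
      (jCore_dSpan_invForms k p 𝔭 e))

/-! ### The exponent of the shifted point -/

/-- **Shifted invariant forms shift the exponent condition**: if `(L_B)_j(𝔭') = (L_B)_{j+m}(𝔭)` for all `j`, then `exponent B(𝔭') ≤ e'` iff
`exponent B(𝔭) ≤ e' + m` (`ExponentLE` only reads the levels `≥` the bound). [cite: Mizutani1973HironakaGroupSchemes, Lemma 2.7 (e(H') ≤ e')] -/
theorem exponentLE_iff_of_invForms_shift {𝔭' : Ideal (MvPolynomial (Fin (n + 1)) k)} {m : ℕ}
    (h : ∀ j, invForms k p 𝔭' j = invForms k p 𝔭 (j + m)) (e' : ℕ) :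
    ExponentLE k p 𝔭' e' ↔ ExponentLE k p 𝔭 (e' + m) := by
  constructor
  · intro hE j hj
    obtain ⟨j₀, rfl⟩ : ∃ j₀, j = j₀ + m := ⟨j - m, by omega⟩
    have h0 := hE j₀ (by omega)
    rw [h, h] at h0
    rw [h0, Nat.add_sub_add_right]
  · intro hE j hj
    rw [h, h, hE (j + m) (by omega), Nat.add_sub_add_right]

/-- **`exponent B(𝔭') = exponent B(𝔭) − m`** (truncated subtraction) when `(L_B)_j(𝔭') = (L_B)_{j+m}(𝔭)` for all `j` — Lemma 2.7's «`e(H') ≤ e'`» sharpened: the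
Frobenius image `F^m(B)` of a scheme of exponent `e` has exponent exactly `e − m` for `m ≤ e` (and `0` for `m ≥ e`).
[cite: Mizutani1973HironakaGroupSchemes, Lemma 2.7 and Remark 2.10 (m(1) ≤ m(2) ≤ … ≤ m(e))] -/
theorem exponent_eq_sub_of_invForms_shift {𝔭' : Ideal (MvPolynomial (Fin (n + 1)) k)} {m : ℕ}
    (h : ∀ j, invForms k p 𝔭' j = invForms k p 𝔭 (j + m)) : exponent k p 𝔭' = exponent k p 𝔭 - m := by
  apply le_antisymm
  · rw [exponent_le_iff, exponentLE_iff_of_invForms_shift k p 𝔭 h]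
    exact (exponentLE_exponent k p 𝔭).mono (by omega)
  · have h1 : ExponentLE k p 𝔭 (exponent k p 𝔭' + m) :=
      (exponentLE_iff_of_invForms_shift k p 𝔭 h _).mp (exponentLE_exponent k p 𝔭')
    have h2 := (exponent_le_iff k p 𝔭).mpr h1
    omega

end Point

end Summit.ResolutionOfSingularities.KangarooAtlas.Mizutani

end
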